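import Mathlib
import Literature.Probability.RandomPlanarGeometry.SelfAvoidingWalk
import HarnessLib
import Summits.CriticalPhenomena.SAWScalingLimit.Theses.SAWQuadrupoleWard

/-!
# Typed decomposition of the crux `BoundaryWard` (route `SAWQuadrupoleWard`): the glue

Crux `Summit.CriticalPhenomena.SAWScalingLimit.Theses.SAWQuadrupoleWard.BoundaryWard`
(stmt-CriticalPhenomena-6556, rank 3): for every mesh normalisation `κ₁, κ₂` satisfying the
interior Ward identity, along the flow `g` of a vector field `u` holomorphic near `D̄` with
`u(a) = u(b) = 0` mapping the Dobrushin domain `D` into itself, the lattice restriction of the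
critical SAW law to the shrinking domains `D_t = g_t(D)` is generated by the collar covariance:
`E_{(D_t)_δ}[f] − E_{D_δ}[f] − ∫₀ᵗ C(s, δ) ds → 0` as `δ → 0⁺`, where
`C(s, δ) = Cov_{(D_s)_δ}(f, Q^κ_δ(2∂̄(χu)))`.

`boundaryWard_of_subs` PROVES the crux from four pieces, one per mechanism acting on a single
flow step `[s, s + h]` (the hypotheses, in this order, stated as closed terms with the crux's own
binders — they are the bodies of the route's child items `ExactRestriction`, `StripAvoidance`,
`CollarTouching`, `ResponseContinuity`; the conclusion is the crux's body verbatim, so that the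
route file can cite this theorem with `route edit --split BoundaryWard --glue-by` without an
import cycle; this file therefore does not import the Theses file):

1. **ExactRestriction** (deterministic; Lawler–Schramm–Werner 2004 §3.4.5 "restriction is exact
   on the lattice", partition-function form `SAW.law_setOf_exists_support_eq_eq` in
   `Literature/…/SAWRestrictionCovariance.lean`): eventually in `δ`, `law (D_s)_δ` is a
   probability measure and `E_{(D_{s+h})_δ}[f] · P_{(D_s)_δ}(Conf) = E_{(D_s)_δ}[f; Conf]`, `Conf` =
   "the walk of `(D_s)_δ` has the support of a walk of `(D_{s+h})_δ`" (its proof needs the flow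
   semigroup `g_{s+h}(D) ⊆ g_s(D)` and `a_δ` in both largest components);
2. **StripAvoidance** (boundary estimate, open): `P_{(D_s)_δ}(Confᶜ) ≤ L · h` eventually in `δ`,
   `L, h₀` uniform along the orbit (continuum value `1 − |g_h′(a) g_h′(b)|^{5/8} = O(h)`);
3. **CollarTouching** (the hard core, open — Cardy's boundary condition "bulk stress tensor at
   the boundary = touching density" in lattice form): `|Cov_{(D_s)_δ}(f, 1_{Confᶜ}) + h · C(s, δ)|
   ≤ η h` eventually in `δ`, for `h ≤ h₀(η)` uniformly in `s`;
4. **ResponseContinuity** (regularity, open): `|h · C(s, δ) − ∫ₛ^{s+h} C(r, δ) dr| ≤ η h`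
   eventually in `δ`, for `h ≤ h₀(η)` uniformly in `s` (cumulative form).

PROOF (genuine, ≈ 200 lines): on one step, exact restriction gives
`ΔF + Θ = ΔF · q` with `q = P(Confᶜ)`, `Θ = Cov(f, 1_{Confᶜ})`, `|Θ| ≤ 2‖f‖ q`, hence
`|ΔF + Θ| ≤ 4‖f‖ q² ≤ 4‖f‖ L² h²`; with pieces 3–4 the one-step error is `≤ 3ηh` once
`h ≤ h₀(η)` (`abs_step_le`); chopping `[0, t]` into `n` equal steps, intersecting the `4n`
eventualities in `δ` and telescoping gives `|E_{(D_t)_δ}[f] − E_{D_δ}[f] − ∫₀ᵗ C| ≤ 3ηt`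
eventually, for every `η > 0` (`tendsto_of_uniform_steps`); `g₀ = id` identifies `D₀ = D`.
The interior Ward hypothesis of the crux is only threaded through to pieces 3–4.

References: Lawler–Schramm–Werner 2004 (arXiv:math/0204277) §3.4.5; Lawler–Schramm–Werner 2003
(restriction exponent 5/8); Cardy, *Scaling and renormalization* (1996) §11.3 and
Chelkak–Glazman–Smirnov arXiv:1604.06339 p. 5 for the boundary condition behind piece 3.
Mathlib anchors: `Finset.sum_range_sub`, `Filter.eventually_all_finset`, `integral_add_compl`,
`norm_setIntegral_le_of_norm_le_const`, `prob_compl_eq_one_sub`.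
-/

namespace Summit.CriticalPhenomena.SAWScalingLimit.Theorems.SAWQuadrupoleWardBoundaryWardSplit

open Filter Set

/-- **One flow step.** Abstract form of the four inputs on a time step `[s, s+h]`:
exact restriction `F₁ (1 - q) = F₀ - A` (`q` = probability that the walk of the big domain
leaves the small one, `A` = the integral of the observable over that event), the covariance
bound `|A - F₀ q| ≤ 2 B q` (`B` = sup-norm of the observable), strip avoidance `q ≤ L h` with
`L h ≤ 1/2`, the touching identity `|(A - F₀ q) + h C| ≤ η h` and response continuity
`|h C - ΔJ| ≤ η h`; if moreover `4 B L² h ≤ η` then `|F₁ - F₀ - ΔJ| ≤ 3 η h`. [folklore] -/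
theorem abs_step_le {F₀ F₁ A q C ΔJ B L η h : ℝ} (hB : 0 ≤ B) (hh : 0 ≤ h)
    (hq : 0 ≤ q) (hqL : q ≤ L * h) (hLh : L * h ≤ 1 / 2)
    (hR : F₁ * (1 - q) = F₀ - A) (hΘ : |A - F₀ * q| ≤ 2 * B * q)
    (hP : |(A - F₀ * q) + h * C| ≤ η * h) (hC : |h * C - ΔJ| ≤ η * h)
    (hsmall : 4 * B * L ^ 2 * h ≤ η) :
    |F₁ - F₀ - ΔJ| ≤ 3 * η * h := by
  -- the restriction identity in covariance form
  have e1 : F₁ - F₀ + (A - F₀ * q) = (F₁ - F₀) * q := by linear_combination hR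
  have e2 : (F₁ - F₀) * (1 - q) = -(A - F₀ * q) := by linear_combination hR
  have hq1 : 1 / 2 ≤ 1 - q := by linarith
  -- |F₁ - F₀| ≤ 4 B q
  have h3 : |F₁ - F₀| * (1 - q) ≤ 2 * B * q := by
    have : |(F₁ - F₀) * (1 - q)| = |F₁ - F₀| * (1 - q) := by
      rw [abs_mul, abs_of_nonneg (by linarith : (0:ℝ) ≤ 1 - q)]
    rw [← this, e2, abs_neg]
    exact hΘ
  have h4 : |F₁ - F₀| ≤ 4 * B * q := by nlinarith [abs_nonneg (F₁ - F₀)]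
  -- first bracket: |F₁ - F₀ + Θ| = |F₁ - F₀| q ≤ 4 B q² ≤ 4 B L² h² ≤ η h
  have hLh0 : 0 ≤ L * h := hq.trans hqL
  have h5 : |F₁ - F₀ + (A - F₀ * q)| ≤ η * h := by
    rw [e1, abs_mul, abs_of_nonneg hq]
    calc |F₁ - F₀| * q ≤ 4 * B * q * q := by nlinarith [abs_nonneg (F₁ - F₀)]
      _ ≤ 4 * B * (L * h) * (L * h) := by
          have hqq : q * q ≤ (L * h) * (L * h) := mul_le_mul hqL hqL hq hLh0
          have h4B : (0:ℝ) ≤ 4 * B := by positivity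
          calc 4 * B * q * q = 4 * B * (q * q) := by ring
            _ ≤ 4 * B * ((L * h) * (L * h)) := mul_le_mul_of_nonneg_left hqq h4B
            _ = 4 * B * (L * h) * (L * h) := by ring
      _ = 4 * B * L ^ 2 * h * h := by ring
      _ ≤ η * h := by nlinarith
  -- triangle inequality
  have key : F₁ - F₀ - ΔJ =
      (F₁ - F₀ + (A - F₀ * q)) + (-((A - F₀ * q) + h * C)) + (h * C - ΔJ) := by ring
  rw [key]
  calc |(F₁ - F₀ + (A - F₀ * q)) + (-((A - F₀ * q) + h * C)) + (h * C - ΔJ)|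
      ≤ |F₁ - F₀ + (A - F₀ * q)| + |(-((A - F₀ * q) + h * C))| + |h * C - ΔJ| :=
        abs_add_three _ _ _
    _ ≤ η * h + η * h + η * h := by rw [abs_neg]; exact add_le_add (add_le_add h5 hP) hC
    _ = 3 * η * h := by ring

/-- **Telescoping.** If for every `η > 0` the one-step error
`|F(s+h) - F(s) - (J(s+h) - J(s))|` is at most `η h`, eventually along `l`, for all steps
`[s, s+h] ⊆ [0, t₀]` of length `h ≤ h₀(η)`, then `F(t) - F(0) - (J(t) - J(0)) → 0` along `l`
for every `t ∈ (0, t₀]` (chop `[0, t]` into `n` equal steps and let `η → 0`). [folklore] -/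
theorem tendsto_of_uniform_steps {l : Filter ℝ} {F J : ℝ → ℝ → ℝ} {t₀ t : ℝ}
    (hstep : ∀ η : ℝ, 0 < η → ∃ h₀ : ℝ, 0 < h₀ ∧ ∀ s ∈ Set.Icc (0:ℝ) t₀, ∀ h ∈ Set.Ioc (0:ℝ) h₀,
      s + h ≤ t₀ → ∀ᶠ δ in l, |F (s + h) δ - F s δ - (J (s + h) δ - J s δ)| ≤ η * h)
    (ht : t ∈ Set.Ioc (0:ℝ) t₀) :
    Tendsto (fun δ => F t δ - F 0 δ - (J t δ - J 0 δ)) l (nhds 0) := by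
  rw [Metric.tendsto_nhds]
  intro ε hε
  obtain ⟨htpos, htle⟩ := ht
  -- choose η with η t = ε / 2 and the step bound h₀
  obtain ⟨h₀, hh₀, H⟩ := hstep (ε / (2 * t)) (by positivity)
  -- number of steps
  obtain ⟨n, hn⟩ : ∃ n : ℕ, t / h₀ ≤ n := exists_nat_ge (t / h₀)
  have hnpos : (0:ℝ) < n := lt_of_lt_of_le (by positivity) hn
  have hn0 : (n:ℝ) ≠ 0 := hnpos.ne'
  set h : ℝ := t / n with hh_def
  have hhpos : 0 < h := by positivity
  have hhle : h ≤ h₀ := by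
    rw [hh_def, div_le_iff₀ hnpos]
    calc t = (t / h₀) * h₀ := by field_simp
      _ ≤ n * h₀ := by gcongr
      _ = h₀ * n := by ring
  have hnh : (n:ℝ) * h = t := by rw [hh_def]; field_simp
  -- the one-step bounds at the grid points, eventually and simultaneously
  have hgrid : ∀ i ∈ Finset.range n, ∀ᶠ δ in l,
      |F ((i:ℝ) * h + h) δ - F ((i:ℝ) * h) δ - (J ((i:ℝ) * h + h) δ - J ((i:ℝ) * h) δ)|
        ≤ ε / (2 * t) * h := by
    intro i hi
    have hi' : (i:ℝ) + 1 ≤ n := by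
      have := Finset.mem_range.1 hi
      exact_mod_cast this
    have hi0 : (0:ℝ) ≤ i := by positivity
    refine H ((i:ℝ) * h) ⟨by positivity, ?_⟩ h ⟨hhpos, hhle⟩ ?_
    · have hin : (i:ℝ) ≤ n := by linarith
      calc (i:ℝ) * h ≤ n * h := mul_le_mul_of_nonneg_right hin hhpos.le
        _ = t := hnh
        _ ≤ t₀ := htle
    · calc (i:ℝ) * h + h = ((i:ℝ) + 1) * h := by ring
        _ ≤ n * h := by gcongr
        _ = t := hnh
        _ ≤ t₀ := htle
  have hall := (Filter.eventually_all_finset (Finset.range n)).2 hgrid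
  refine hall.mono fun δ hδ => ?_
  -- telescoping sum
  have tele : F t δ - F 0 δ - (J t δ - J 0 δ) =
      ∑ i ∈ Finset.range n, ((F (((i+1:ℕ):ℝ) * h) δ - J (((i+1:ℕ):ℝ) * h) δ) -
        (F ((i:ℝ) * h) δ - J ((i:ℝ) * h) δ)) := by
    rw [Finset.sum_range_sub (fun i : ℕ => F ((i:ℝ) * h) δ - J ((i:ℝ) * h) δ) n]
    simp only [Nat.cast_zero, zero_mul, hnh]
    ring
  rw [Real.dist_eq, sub_zero, tele]
  calc |∑ i ∈ Finset.range n, ((F (((i+1:ℕ):ℝ) * h) δ - J (((i+1:ℕ):ℝ) * h) δ) -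
          (F ((i:ℝ) * h) δ - J ((i:ℝ) * h) δ))|
      ≤ ∑ i ∈ Finset.range n, |(F (((i+1:ℕ):ℝ) * h) δ - J (((i+1:ℕ):ℝ) * h) δ) -
          (F ((i:ℝ) * h) δ - J ((i:ℝ) * h) δ)| := Finset.abs_sum_le_sum_abs _ _
    _ ≤ ∑ i ∈ Finset.range n, ε / (2 * t) * h := by
        refine Finset.sum_le_sum fun i hi => ?_
        have := hδ i hi
        have e : ((i+1:ℕ):ℝ) * h = (i:ℝ) * h + h := by push_cast; ring
        rw [e]
        calc |F ((i:ℝ) * h + h) δ - J ((i:ℝ) * h + h) δ - (F ((i:ℝ) * h) δ - J ((i:ℝ) * h) δ)|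
            = |F ((i:ℝ) * h + h) δ - F ((i:ℝ) * h) δ -
                (J ((i:ℝ) * h + h) δ - J ((i:ℝ) * h) δ)| := by ring_nf
          _ ≤ ε / (2 * t) * h := this
    _ = n * (ε / (2 * t) * h) := by rw [Finset.sum_const, Finset.card_range, nsmul_eq_mul]
    _ = ε / 2 := by rw [← hnh]; field_simp
    _ < ε := by linarith

end Summit.CriticalPhenomena.SAWScalingLimit.Theorems.SAWQuadrupoleWardBoundaryWardSplit

namespace Summit.CriticalPhenomena.SAWScalingLimit.Theorems.SAWQuadrupoleWardBoundaryWardSplit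

open MeasureTheory Filter Set
open scoped Topology ENNReal
open Literature.Probability.LatticeModels Literature.Probability.RandomPlanarGeometry
open Literature.Probability.RandomPlanarGeometry.SAW

/-! ## Measure-theoretic facts about the observable `γ ↦ f(γ.curve)` -/

section Obs

variable {Ω : Set ℂ} {δ : ℝ} {a' b' : Site 2}

/-- A bounded continuous observable of the curve is integrable against any finite measure on the
(discrete) space of SAWs. [folklore] -/
theorem integrable_obs (f : BoundedContinuousFunction (CurveClass ℂ) ℝ)
    (μ : Measure (DomainSAW Ω δ a' b')) [IsFiniteMeasure μ] :
    Integrable (fun γ => f γ.curve) μ :=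
  Integrable.of_bound (DomainSAW.measurable_of_top _).aestronglyMeasurable ‖f‖
    (Eventually.of_forall fun γ => f.norm_coe_le_norm γ.curve)

/-- **Covariance with an indicator is at most `2‖f‖` times the probability**: for a probability
measure `μ` and any event `S`, `|∫_S f − (∫ f) · μ(S)| ≤ 2 ‖f‖ μ(S)`. [folklore] -/
theorem abs_setIntegral_sub_mul_le (f : BoundedContinuousFunction (CurveClass ℂ) ℝ)
    (μ : Measure (DomainSAW Ω δ a' b')) [IsProbabilityMeasure μ] (S : Set (DomainSAW Ω δ a' b')) :
    |(∫ γ in S, f γ.curve ∂μ) - (∫ γ, f γ.curve ∂μ) * (μ S).toReal| ≤ 2 * ‖f‖ * (μ S).toReal := by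
  have hint : Integrable (fun γ => f γ.curve) μ := integrable_obs f μ
  have hF : |∫ γ, f γ.curve ∂μ| ≤ ‖f‖ := by
    have h := norm_integral_le_of_norm_le_const (μ := μ) (f := fun γ => f γ.curve) (C := ‖f‖)
      (Eventually.of_forall fun γ => f.norm_coe_le_norm γ.curve)
    simpa [Real.norm_eq_abs] using h
  have e : (∫ γ in S, f γ.curve ∂μ) - (∫ γ, f γ.curve ∂μ) * (μ S).toReal =
      ∫ γ in S, (f γ.curve - ∫ γ', f γ'.curve ∂μ) ∂μ := by
    rw [integral_sub hint.integrableOn (integrableOn_const (hs := measure_ne_top μ S)),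
      setIntegral_const, measureReal_def, smul_eq_mul, mul_comm]
  rw [e]
  have hb : ∀ γ ∈ S, ‖f γ.curve - ∫ γ', f γ'.curve ∂μ‖ ≤ 2 * ‖f‖ := by
    intro γ _
    calc ‖f γ.curve - ∫ γ', f γ'.curve ∂μ‖ ≤ ‖f γ.curve‖ + ‖∫ γ', f γ'.curve ∂μ‖ := norm_sub_le _ _
      _ ≤ ‖f‖ + ‖f‖ := add_le_add (f.norm_coe_le_norm γ.curve) (by simpa [Real.norm_eq_abs] using hF)
      _ = 2 * ‖f‖ := by ring
  have h := norm_setIntegral_le_of_norm_le_const (measure_lt_top μ S) hb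
  rw [measureReal_def, Real.norm_eq_abs] at h
  exact h

/-- For a probability measure, `μ(S) = 1 − μ(Sᶜ)` in `ℝ`. [folklore] -/
theorem toReal_eq_one_sub_toReal_compl (μ : Measure (DomainSAW Ω δ a' b')) [IsProbabilityMeasure μ]
    (S : Set (DomainSAW Ω δ a' b')) : (μ S).toReal = 1 - (μ Sᶜ).toReal := by
  have hS : MeasurableSet S := MeasurableSpace.measurableSet_top
  have h := prob_compl_eq_one_sub hS (μ := μ)
  rw [h, ENNReal.toReal_sub_of_le prob_le_one ENNReal.one_ne_top, ENNReal.toReal_one]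
  ring

/-- `∫_S f = ∫ f − ∫_{Sᶜ} f`. [folklore] -/
theorem setIntegral_eq_integral_sub_compl (f : BoundedContinuousFunction (CurveClass ℂ) ℝ)
    (μ : Measure (DomainSAW Ω δ a' b')) [IsFiniteMeasure μ] (S : Set (DomainSAW Ω δ a' b')) :
    ∫ γ in S, f γ.curve ∂μ = (∫ γ, f γ.curve ∂μ) - ∫ γ in Sᶜ, f γ.curve ∂μ := by
  have h := integral_add_compl (MeasurableSpace.measurableSet_top (s := S)) (integrable_obs f μ)
  linarith

end Obs

/-! ## The glue -/

/-- **The typed decomposition of `BoundaryWard`.** Exact lattice restriction along the flow,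
strip avoidance, the collar/touching identity and the equicontinuity of the collar response
imply the boundary Ward identity `BoundaryWard` (stmt-CriticalPhenomena-6556) of route
`SAWQuadrupoleWard`: on each flow step `[s, s+h]` the four inputs give
`|E_{(D_{s+h})_δ}[f] − E_{(D_s)_δ}[f] − ∫ₛ^{s+h} C(r, δ) dr| ≤ 3ηh` eventually in `δ`
(`abs_step_le`), and chopping `[0, t]` into `n` steps of length `≤ h₀(η)` gives
`|E_{(D_t)_δ}[f] − E_{D_δ}[f] − ∫₀ᵗ C| ≤ 3ηt` eventually, for every `η > 0`
(`tendsto_of_uniform_steps`). [folklore] -/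
theorem boundaryWard_of_subs
    (hR : ∀ (D : Literature.Probability.RandomPlanarGeometry.DobrushinDomain) (a b : ℝ → Literature.Probability.LatticeModels.Site 2), Literature.Probability.RandomPlanarGeometry.SAW.IsEndpointApprox D a b → let P := fun (Ω : Set ℂ) (δ : ℝ) => Literature.Probability.RandomPlanarGeometry.SAW.law Ω δ (a δ) (b δ); ∀ (u : ℂ → ℂ) (U : Set ℂ), IsOpen U → closure D.carrier ⊆ U → DifferentiableOn ℂ u U → ContDiff ℝ 2 u → u (D.pt 0) = 0 → u (D.pt 1) = 0 → ∀ (g : ℝ → ℂ → ℂ) (hg : ∀ t, Continuous (g t)) (t₀ : ℝ), 0 < t₀ → (∀ z, g 0 z = z) → (∀ t, ∃ K, LipschitzWith K (g t)) → (∀ t ∈ Set.Icc (0 : ℝ) t₀, ∀ z ∈ closure D.carrier, HasDerivAt (fun r => g r z) (u (g t z)) t) → (∀ t ∈ Set.Icc (0 : ℝ) t₀, g t '' D.carrier ⊆ D.carrier) → (∀ t ∈ Set.Icc (0 : ℝ) t₀, ∀ᶠ δ in nhdsWithin 0 (Set.Ioi 0), (Literature.Probability.LatticeModels.discreteDomainGraph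 (g t '' D.carrier) δ).Reachable (a δ) (b δ)) → ∀ f : BoundedContinuousFunction (Literature.Probability.RandomPlanarGeometry.CurveClass ℂ) ℝ, ∀ s ∈ Set.Icc (0 : ℝ) t₀, ∀ h : ℝ, 0 < h → s + h ≤ t₀ → ∀ᶠ δ in nhdsWithin 0 (Set.Ioi 0), MeasureTheory.IsProbabilityMeasure (P (g s '' D.carrier) δ) ∧ (∫ γ, f γ.curve ∂(P (g (s + h) '' D.carrier) δ)) * ((P (g s '' D.carrier) δ) {γ | ∃ γ' : Literature.Probability.RandomPlanarGeometry.SAW.DomainSAW (g (s + h) '' D.carrier) δ (a δ) (b δ), γ'.walk.support = γ.walk.support}).toReal = ∫ γ in {γ | ∃ γ' : Literature.Probability.RandomPlanarGeometry.SAW.DomainSAW (g (s + h) '' D.carrier) δ (a δ) (b δ), γ'.walk.support = γ.walk.support}, f γ.curve ∂(P (g s '' D.carrier) δ))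
    (hV : ∀ (D : Literature.Probability.RandomPlanarGeometry.DobrushinDomain) (a b : ℝ → Literature.Probability.LatticeModels.Site 2), Literature.Probability.RandomPlanarGeometry.SAW.IsEndpointApprox D a b → let P := fun (Ω : Set ℂ) (δ : ℝ) => Literature.Probability.RandomPlanarGeometry.SAW.law Ω δ (a δ) (b δ); ∀ (u : ℂ → ℂ) (U : Set ℂ), IsOpen U → closure D.carrier ⊆ U → DifferentiableOn ℂ u U → ContDiff ℝ 2 u → u (D.pt 0) = 0 → u (D.pt 1) = 0 → ∀ (g : ℝ → ℂ → ℂ) (hg : ∀ t, Continuous (g t)) (t₀ : ℝ), 0 < t₀ → (∀ z, g 0 z = z) → (∀ t, ∃ K, LipschitzWith K (g t)) → (∀ t ∈ Set.Icc (0 : ℝ) t₀, ∀ z ∈ closure D.carrier, HasDerivAt (fun r => g r z) (u (g t z)) t) → (∀ t ∈ Set.Icc (0 : ℝ) t₀, g t '' D.carrier ⊆ D.carrier) → (∀ t ∈ Set.Icc (0 : ℝ) t₀, ∀ᶠ δ in nhdsWithin 0 (Set.Ioi 0), (Literature.Probability.LatticeModels.discreteDomainGraph (g t '' D.carrier) δ).Reachable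 (a δ) (b δ)) → ∃ L : ℝ, ∃ h₀ : ℝ, 0 < h₀ ∧ ∀ s ∈ Set.Icc (0 : ℝ) t₀, ∀ h ∈ Set.Ioc (0 : ℝ) h₀, s + h ≤ t₀ → ∀ᶠ δ in nhdsWithin 0 (Set.Ioi 0), ((P (g s '' D.carrier) δ) {γ | ∃ γ' : Literature.Probability.RandomPlanarGeometry.SAW.DomainSAW (g (s + h) '' D.carrier) δ (a δ) (b δ), γ'.walk.support = γ.walk.support}ᶜ).toReal ≤ L * h)
    (hP : ∀ κ₁ κ₂ : ℝ → ℝ, (∀ (D : Literature.Probability.RandomPlanarGeometry.DobrushinDomain) (a b : ℝ → Literature.Probability.LatticeModels.Site 2), Literature.Probability.RandomPlanarGeometry.SAW.IsEndpointApprox D a b → let P := fun (Ω : Set ℂ) (δ : ℝ) => Literature.Probability.RandomPlanarGeometry.SAW.law Ω δ (a δ) (b δ); ∀ (v : ℂ → ℂ), ContDiff ℝ 2 v → tsupport v ⊆ D.carrier → ∀ (φ : ℝ → ℂ → ℂ) (hφ : ∀ t, Continuous (φ t)), (∀ z, φ 0 z = z) → (∀ t z, HasDerivAt (fun r => φ r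 z) (v (φ t z)) t) → ∀ f : BoundedContinuousFunction (Literature.Probability.RandomPlanarGeometry.CurveClass ℂ) ℝ, let strain : (ℂ → ℂ) → ℂ → ℂ := fun w z => fderiv ℝ w z 1 + Complex.I * fderiv ℝ w z Complex.I; let quad : ℝ → (ℂ → ℂ) → List (Literature.Probability.LatticeModels.Site 2) → ℝ := fun δ s xs => let l := xs.map (Literature.Probability.LatticeModels.meshPoint δ); κ₁ δ * (List.zipWith (fun p q : ℂ => (s ((p + q) / 2)).re * (((q - p).re) ^ 2 - ((q - p).im) ^ 2) / δ ^ 2) l l.tail).sum + κ₂ δ * (List.zipWith3 (fun p q r : ℂ => (s q).im * ((r - p).re * (r - p).im) / δ ^ 2) l l.tail l.tail.tail).sum; let fbar : Literature.Probability.RandomPlanarGeometry.CurveClass ℂ → ℝ := fun c => ∫ t in (0 : ℝ)..1, f (Literature.Probability.RandomPlanarGeometry.CurveClass.map ⟨φ t, hφ t⟩ c); Filter.Tendsto (fun δ : ℝ => (∫ γ, f (Literature.Probability.RandomPlanarGeometry.CurveClass.map ⟨φ 1, hφ 1⟩ γ.curve) ∂(P D.carrier δ)) - (∫ γ, f γ.curve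 ∂(P D.carrier δ)) - ((∫ γ, fbar γ.curve * quad δ (strain v) γ.walk.support ∂(P D.carrier δ)) - (∫ γ, fbar γ.curve ∂(P D.carrier δ)) * (∫ γ, quad δ (strain v) γ.walk.support ∂(P D.carrier δ)))) (nhdsWithin 0 (Set.Ioi 0)) (nhds 0)) → ∀ (D : Literature.Probability.RandomPlanarGeometry.DobrushinDomain) (a b : ℝ → Literature.Probability.LatticeModels.Site 2), Literature.Probability.RandomPlanarGeometry.SAW.IsEndpointApprox D a b → let P := fun (Ω : Set ℂ) (δ : ℝ) => Literature.Probability.RandomPlanarGeometry.SAW.law Ω δ (a δ) (b δ); ∀ (u : ℂ → ℂ) (U : Set ℂ), IsOpen U → closure D.carrier ⊆ U → DifferentiableOn ℂ u U → ContDiff ℝ 2 u → u (D.pt 0) = 0 → u (D.pt 1) = 0 → ∀ (g : ℝ → ℂ → ℂ) (hg : ∀ t, Continuous (g t)) (t₀ : ℝ), 0 < t₀ → (∀ z, g 0 z = z) → (∀ t, ∃ K, LipschitzWith K (g t)) → (∀ t ∈ Set.Icc (0 : ℝ) t₀, ∀ z ∈ closure D.carrier, HasDerivAt (fun r => g r z)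 (u (g t z)) t) → (∀ t ∈ Set.Icc (0 : ℝ) t₀, g t '' D.carrier ⊆ D.carrier) → (∀ t ∈ Set.Icc (0 : ℝ) t₀, ∀ᶠ δ in nhdsWithin 0 (Set.Ioi 0), (Literature.Probability.LatticeModels.discreteDomainGraph (g t '' D.carrier) δ).Reachable (a δ) (b δ)) → ∀ (K : Set ℂ), IsCompact K → K ⊆ g t₀ '' D.carrier → ∀ (χ : ℂ → ℝ), ContDiff ℝ 2 χ → (∀ᶠ z in nhdsSet K, χ z = 1) → tsupport χ ⊆ g t₀ '' D.carrier → ∀ f : BoundedContinuousFunction (Literature.Probability.RandomPlanarGeometry.CurveClass ℂ) ℝ, (∀ ψ : ℂ ≃ₜ ℂ, (∀ z ∈ K, ψ z = z) → ∀ c, f (Literature.Probability.RandomPlanarGeometry.CurveClass.map (ψ : C(ℂ, ℂ)) c) = f c) → ∀ η : ℝ, 0 < η → ∃ h₀ : ℝ, 0 < h₀ ∧ ∀ s ∈ Set.Icc (0 : ℝ) t₀, ∀ h ∈ Set.Ioc (0 : ℝ) h₀, s + h ≤ t₀ → let strain : (ℂ → ℂ) → ℂ → ℂ := fun w z => fderiv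 ℝ w z 1 + Complex.I * fderiv ℝ w z Complex.I; let quad : ℝ → (ℂ → ℂ) → List (Literature.Probability.LatticeModels.Site 2) → ℝ := fun δ s xs => let l := xs.map (Literature.Probability.LatticeModels.meshPoint δ); κ₁ δ * (List.zipWith (fun p q : ℂ => (s ((p + q) / 2)).re * (((q - p).re) ^ 2 - ((q - p).im) ^ 2) / δ ^ 2) l l.tail).sum + κ₂ δ * (List.zipWith3 (fun p q r : ℂ => (s q).im * ((r - p).re * (r - p).im) / δ ^ 2) l l.tail l.tail.tail).sum; let v : ℂ → ℂ := fun z => (χ z : ℂ) * u z; ∀ᶠ δ in nhdsWithin 0 (Set.Ioi 0), |((∫ γ in {γ | ∃ γ' : Literature.Probability.RandomPlanarGeometry.SAW.DomainSAW (g (s + h) '' D.carrier) δ (a δ) (b δ), γ'.walk.support = γ.walk.support}ᶜ, f γ.curve ∂(P (g s '' D.carrier) δ)) - (∫ γ, f γ.curve ∂(P (g s '' D.carrier) δ)) * ((P (g s '' D.carrier) δ) {γ | ∃ γ' : Literature.Probability.RandomPlanarGeometry.SAW.DomainSAW (g (s + h) '' D.carrier) δ (a δ) (b δ), γ'.walk.support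 = γ.walk.support}ᶜ).toReal) + h * ((∫ γ, f γ.curve * quad δ (strain v) γ.walk.support ∂(P (g s '' D.carrier) δ)) - (∫ γ, f γ.curve ∂(P (g s '' D.carrier) δ)) * (∫ γ, quad δ (strain v) γ.walk.support ∂(P (g s '' D.carrier) δ)))| ≤ η * h)
    (hC : ∀ κ₁ κ₂ : ℝ → ℝ, (∀ (D : Literature.Probability.RandomPlanarGeometry.DobrushinDomain) (a b : ℝ → Literature.Probability.LatticeModels.Site 2), Literature.Probability.RandomPlanarGeometry.SAW.IsEndpointApprox D a b → let P := fun (Ω : Set ℂ) (δ : ℝ) => Literature.Probability.RandomPlanarGeometry.SAW.law Ω δ (a δ) (b δ); ∀ (v : ℂ → ℂ), ContDiff ℝ 2 v → tsupport v ⊆ D.carrier → ∀ (φ : ℝ → ℂ → ℂ) (hφ : ∀ t, Continuous (φ t)), (∀ z, φ 0 z = z) → (∀ t z, HasDerivAt (fun r => φ r z) (v (φ t z)) t) → ∀ f : BoundedContinuousFunction (Literature.Probability.RandomPlanarGeometry.CurveClass ℂ) ℝ, let strain : (ℂ → ℂ) → ℂ → ℂ := fun w z => fderiv ℝ w z 1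 + Complex.I * fderiv ℝ w z Complex.I; let quad : ℝ → (ℂ → ℂ) → List (Literature.Probability.LatticeModels.Site 2) → ℝ := fun δ s xs => let l := xs.map (Literature.Probability.LatticeModels.meshPoint δ); κ₁ δ * (List.zipWith (fun p q : ℂ => (s ((p + q) / 2)).re * (((q - p).re) ^ 2 - ((q - p).im) ^ 2) / δ ^ 2) l l.tail).sum + κ₂ δ * (List.zipWith3 (fun p q r : ℂ => (s q).im * ((r - p).re * (r - p).im) / δ ^ 2) l l.tail l.tail.tail).sum; let fbar : Literature.Probability.RandomPlanarGeometry.CurveClass ℂ → ℝ := fun c => ∫ t in (0 : ℝ)..1, f (Literature.Probability.RandomPlanarGeometry.CurveClass.map ⟨φ t, hφ t⟩ c); Filter.Tendsto (fun δ : ℝ => (∫ γ, f (Literature.Probability.RandomPlanarGeometry.CurveClass.map ⟨φ 1, hφ 1⟩ γ.curve) ∂(P D.carrier δ)) - (∫ γ, f γ.curve ∂(P D.carrier δ)) - ((∫ γ, fbar γ.curve * quad δ (strain v) γ.walk.support ∂(P D.carrier δ)) - (∫ γ, fbar γ.curve ∂(P D.carrier δ)) * (∫ γ, quad δ (strain v)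 γ.walk.support ∂(P D.carrier δ)))) (nhdsWithin 0 (Set.Ioi 0)) (nhds 0)) → ∀ (D : Literature.Probability.RandomPlanarGeometry.DobrushinDomain) (a b : ℝ → Literature.Probability.LatticeModels.Site 2), Literature.Probability.RandomPlanarGeometry.SAW.IsEndpointApprox D a b → let P := fun (Ω : Set ℂ) (δ : ℝ) => Literature.Probability.RandomPlanarGeometry.SAW.law Ω δ (a δ) (b δ); ∀ (u : ℂ → ℂ) (U : Set ℂ), IsOpen U → closure D.carrier ⊆ U → DifferentiableOn ℂ u U → ContDiff ℝ 2 u → u (D.pt 0) = 0 → u (D.pt 1) = 0 → ∀ (g : ℝ → ℂ → ℂ) (hg : ∀ t, Continuous (g t)) (t₀ : ℝ), 0 < t₀ → (∀ z, g 0 z = z) → (∀ t, ∃ K, LipschitzWith K (g t)) → (∀ t ∈ Set.Icc (0 : ℝ) t₀, ∀ z ∈ closure D.carrier, HasDerivAt (fun r => g r z) (u (g t z)) t) → (∀ t ∈ Set.Icc (0 : ℝ) t₀, g t '' D.carrier ⊆ D.carrier) → (∀ t ∈ Set.Icc (0 : ℝ) t₀, ∀ᶠ δ in nhdsWithin 0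 (Set.Ioi 0), (Literature.Probability.LatticeModels.discreteDomainGraph (g t '' D.carrier) δ).Reachable (a δ) (b δ)) → ∀ (K : Set ℂ), IsCompact K → K ⊆ g t₀ '' D.carrier → ∀ (χ : ℂ → ℝ), ContDiff ℝ 2 χ → (∀ᶠ z in nhdsSet K, χ z = 1) → tsupport χ ⊆ g t₀ '' D.carrier → ∀ f : BoundedContinuousFunction (Literature.Probability.RandomPlanarGeometry.CurveClass ℂ) ℝ, (∀ ψ : ℂ ≃ₜ ℂ, (∀ z ∈ K, ψ z = z) → ∀ c, f (Literature.Probability.RandomPlanarGeometry.CurveClass.map (ψ : C(ℂ, ℂ)) c) = f c) → ∀ η : ℝ, 0 < η → ∃ h₀ : ℝ, 0 < h₀ ∧ ∀ s ∈ Set.Icc (0 : ℝ) t₀, ∀ h ∈ Set.Ioc (0 : ℝ) h₀, s + h ≤ t₀ → let strain : (ℂ → ℂ) → ℂ → ℂ := fun w z => fderiv ℝ w z 1 + Complex.I * fderiv ℝ w z Complex.I; let quad : ℝ → (ℂ → ℂ) → List (Literature.Probability.LatticeModels.Site 2) → ℝ := fun δ s xs => let l := xs.map (Literature.Probability.LatticeModels.meshPoint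 δ); κ₁ δ * (List.zipWith (fun p q : ℂ => (s ((p + q) / 2)).re * (((q - p).re) ^ 2 - ((q - p).im) ^ 2) / δ ^ 2) l l.tail).sum + κ₂ δ * (List.zipWith3 (fun p q r : ℂ => (s q).im * ((r - p).re * (r - p).im) / δ ^ 2) l l.tail l.tail.tail).sum; let v : ℂ → ℂ := fun z => (χ z : ℂ) * u z; let C : ℝ → ℝ → ℝ := fun r δ => ((∫ γ, f γ.curve * quad δ (strain v) γ.walk.support ∂(P (g r '' D.carrier) δ)) - (∫ γ, f γ.curve ∂(P (g r '' D.carrier) δ)) * (∫ γ, quad δ (strain v) γ.walk.support ∂(P (g r '' D.carrier) δ))); ∀ᶠ δ in nhdsWithin 0 (Set.Ioi 0), |h * C s δ - ((∫ r in (0 : ℝ)..(s + h), C r δ) - (∫ r in (0 : ℝ)..s, C r δ))| ≤ η * h) :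
    ∀ κ₁ κ₂ : ℝ → ℝ, (∀ (D : Literature.Probability.RandomPlanarGeometry.DobrushinDomain) (a b : ℝ → Literature.Probability.LatticeModels.Site 2), Literature.Probability.RandomPlanarGeometry.SAW.IsEndpointApprox D a b → let P := fun (Ω : Set ℂ) (δ : ℝ) => Literature.Probability.RandomPlanarGeometry.SAW.law Ω δ (a δ) (b δ); ∀ (v : ℂ → ℂ), ContDiff ℝ 2 v → tsupport v ⊆ D.carrier → ∀ (φ : ℝ → ℂ → ℂ) (hφ : ∀ t, Continuous (φ t)), (∀ z, φ 0 z = z) → (∀ t z, HasDerivAt (fun r => φ r z) (v (φ t z)) t) → ∀ f : BoundedContinuousFunction (Literature.Probability.RandomPlanarGeometry.CurveClass ℂ) ℝ, let strain : (ℂ → ℂ) → ℂ → ℂ := fun w z => fderiv ℝ w z 1 + Complex.I * fderiv ℝ w z Complex.I; let quad : ℝ → (ℂ → ℂ) → List (Literature.Probability.LatticeModels.Site 2) → ℝ := fun δ s xs => let l := xs.map (Literature.Probability.LatticeModels.meshPoint δ); κ₁ δ * (List.zipWith (fun p q : ℂ => (s ((p + q) / 2)).re * (((q - p).re) ^ 2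 - ((q - p).im) ^ 2) / δ ^ 2) l l.tail).sum + κ₂ δ * (List.zipWith3 (fun p q r : ℂ => (s q).im * ((r - p).re * (r - p).im) / δ ^ 2) l l.tail l.tail.tail).sum; let fbar : Literature.Probability.RandomPlanarGeometry.CurveClass ℂ → ℝ := fun c => ∫ t in (0 : ℝ)..1, f (Literature.Probability.RandomPlanarGeometry.CurveClass.map ⟨φ t, hφ t⟩ c); Filter.Tendsto (fun δ : ℝ => (∫ γ, f (Literature.Probability.RandomPlanarGeometry.CurveClass.map ⟨φ 1, hφ 1⟩ γ.curve) ∂(P D.carrier δ)) - (∫ γ, f γ.curve ∂(P D.carrier δ)) - ((∫ γ, fbar γ.curve * quad δ (strain v) γ.walk.support ∂(P D.carrier δ)) - (∫ γ, fbar γ.curve ∂(P D.carrier δ)) * (∫ γ, quad δ (strain v) γ.walk.support ∂(P D.carrier δ)))) (nhdsWithin 0 (Set.Ioi 0)) (nhds 0)) → ∀ (D : Literature.Probability.RandomPlanarGeometry.DobrushinDomain) (a b : ℝ → Literature.Probability.LatticeModels.Site 2), Literature.Probability.RandomPlanarGeometry.SAW.IsEndpointApprox D a b → let P := fun (Ω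 : Set ℂ) (δ : ℝ) => Literature.Probability.RandomPlanarGeometry.SAW.law Ω δ (a δ) (b δ); ∀ (u : ℂ → ℂ) (U : Set ℂ), IsOpen U → closure D.carrier ⊆ U → DifferentiableOn ℂ u U → ContDiff ℝ 2 u → u (D.pt 0) = 0 → u (D.pt 1) = 0 → ∀ (g : ℝ → ℂ → ℂ) (hg : ∀ t, Continuous (g t)) (t₀ : ℝ), 0 < t₀ → (∀ z, g 0 z = z) → (∀ t, ∃ K, LipschitzWith K (g t)) → (∀ t ∈ Set.Icc (0 : ℝ) t₀, ∀ z ∈ closure D.carrier, HasDerivAt (fun r => g r z) (u (g t z)) t) → (∀ t ∈ Set.Icc (0 : ℝ) t₀, g t '' D.carrier ⊆ D.carrier) → (∀ t ∈ Set.Icc (0 : ℝ) t₀, ∀ᶠ δ in nhdsWithin 0 (Set.Ioi 0), (Literature.Probability.LatticeModels.discreteDomainGraph (g t '' D.carrier) δ).Reachable (a δ) (b δ)) → ∀ (K : Set ℂ), IsCompact K → K ⊆ g t₀ '' D.carrier → ∀ (χ : ℂ → ℝ), ContDiff ℝ 2 χ → (∀ᶠ z in nhdsSet K, χ z = 1)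 → tsupport χ ⊆ g t₀ '' D.carrier → ∀ f : BoundedContinuousFunction (Literature.Probability.RandomPlanarGeometry.CurveClass ℂ) ℝ, (∀ ψ : ℂ ≃ₜ ℂ, (∀ z ∈ K, ψ z = z) → ∀ c, f (Literature.Probability.RandomPlanarGeometry.CurveClass.map (ψ : C(ℂ, ℂ)) c) = f c) → ∀ t ∈ Set.Ioc (0 : ℝ) t₀, let strain : (ℂ → ℂ) → ℂ → ℂ := fun w z => fderiv ℝ w z 1 + Complex.I * fderiv ℝ w z Complex.I; let quad : ℝ → (ℂ → ℂ) → List (Literature.Probability.LatticeModels.Site 2) → ℝ := fun δ s xs => let l := xs.map (Literature.Probability.LatticeModels.meshPoint δ); κ₁ δ * (List.zipWith (fun p q : ℂ => (s ((p + q) / 2)).re * (((q - p).re) ^ 2 - ((q - p).im) ^ 2) / δ ^ 2) l l.tail).sum + κ₂ δ * (List.zipWith3 (fun p q r : ℂ => (s q).im * ((r - p).re * (r - p).im) / δ ^ 2) l l.tail l.tail.tail).sum; let v : ℂ → ℂ := fun z => (χ z : ℂ) * u z; Filter.Tendsto (fun δ : ℝ => (∫ γ, f γ.curve ∂(P (g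 t '' D.carrier) δ)) - (∫ γ, f γ.curve ∂(P D.carrier δ)) - ∫ s in (0 : ℝ)..t, ((∫ γ, f γ.curve * quad δ (strain v) γ.walk.support ∂(P (g s '' D.carrier) δ)) - (∫ γ, f γ.curve ∂(P (g s '' D.carrier) δ)) * (∫ γ, quad δ (strain v) γ.walk.support ∂(P (g s '' D.carrier) δ)))) (nhdsWithin 0 (Set.Ioi 0)) (nhds 0) := by
  intro κ₁ κ₂ hIW D a b hab P u U hU hDU hud huc hua hub g hg t₀ ht₀ hg0 hgL hgd hgD hreach
    K hK hKD χ hχ hχ1 hχD f hf t ht strain quad v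
  -- names for the quantities along the orbit (all plain functions of real parameters)
  let F : ℝ → ℝ → ℝ := fun s δ => ∫ γ, f γ.curve ∂(P (g s '' D.carrier) δ)
  let Cv : ℝ → ℝ → ℝ := fun r δ =>
    (∫ γ, f γ.curve * quad δ (strain v) γ.walk.support ∂(P (g r '' D.carrier) δ)) -
      (∫ γ, f γ.curve ∂(P (g r '' D.carrier) δ)) *
        (∫ γ, quad δ (strain v) γ.walk.support ∂(P (g r '' D.carrier) δ))
  let J : ℝ → ℝ → ℝ := fun s δ => ∫ r in (0:ℝ)..s, Cv r δ
  let Conf : (s h δ : ℝ) → Set (DomainSAW (g s '' D.carrier) δ (a δ) (b δ)) := fun s h δ =>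
    {γ | ∃ γ' : DomainSAW (g (s + h) '' D.carrier) δ (a δ) (b δ), γ'.walk.support = γ.walk.support}
  let q : ℝ → ℝ → ℝ → ℝ := fun s h δ => ((P (g s '' D.carrier) δ) (Conf s h δ)ᶜ).toReal
  let A : ℝ → ℝ → ℝ → ℝ := fun s h δ => ∫ γ in (Conf s h δ)ᶜ, f γ.curve ∂(P (g s '' D.carrier) δ)
  -- Step 1: the uniform one-step estimate from the four pieces
  have hsteps : ∀ η : ℝ, 0 < η → ∃ h₀ : ℝ, 0 < h₀ ∧ ∀ s ∈ Set.Icc (0:ℝ) t₀,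
      ∀ h ∈ Set.Ioc (0:ℝ) h₀, s + h ≤ t₀ →
        ∀ᶠ δ in 𝓝[>] (0:ℝ), |F (s + h) δ - F s δ - (J (s + h) δ - J s δ)| ≤ η * h := by
    intro η hη
    obtain ⟨L, h₁, hh₁, HV⟩ :=
      hV D a b hab u U hU hDU hud huc hua hub g hg t₀ ht₀ hg0 hgL hgd hgD hreach
    obtain ⟨h₂, hh₂, HP⟩ := hP κ₁ κ₂ hIW D a b hab u U hU hDU hud huc hua hub g hg t₀ ht₀ hg0
      hgL hgd hgD hreach K hK hKD χ hχ hχ1 hχD f hf (η / 3) (by positivity)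
    obtain ⟨h₃, hh₃, HC⟩ := hC κ₁ κ₂ hIW D a b hab u U hU hDU hud huc hua hub g hg t₀ ht₀ hg0
      hgL hgd hgD hreach K hK hKD χ hχ hχ1 hχD f hf (η / 3) (by positivity)
    set L' : ℝ := max L 1 with hL'
    have hL'1 : 1 ≤ L' := le_max_right _ _
    have hL'pos : 0 < L' := by positivity
    set B : ℝ := ‖f‖ with hB
    have hB0 : 0 ≤ B := norm_nonneg f
    refine ⟨min (min h₁ (min h₂ h₃)) (min (1 / (2 * L')) ((η / 3) / (4 * B * L' ^ 2 + 1))),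
      by positivity, ?_⟩
    intro s hs h hh hsh
    have hh0 : 0 < h := hh.1
    have hhA : h ≤ min h₁ (min h₂ h₃) := hh.2.trans (min_le_left _ _)
    have hhB : h ≤ min (1 / (2 * L')) ((η / 3) / (4 * B * L' ^ 2 + 1)) :=
      hh.2.trans (min_le_right _ _)
    have hh1 : h ≤ h₁ := hhA.trans (min_le_left _ _)
    have hh2 : h ≤ h₂ := hhA.trans ((min_le_right _ _).trans (min_le_left _ _))
    have hh3 : h ≤ h₃ := hhA.trans ((min_le_right _ _).trans (min_le_right _ _))
    have hhL : h ≤ 1 / (2 * L') := hhB.trans (min_le_left _ _)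
    have hhη : h ≤ (η / 3) / (4 * B * L' ^ 2 + 1) := hhB.trans (min_le_right _ _)
    -- the four pieces at this step
    have eR : ∀ᶠ δ in 𝓝[>] (0:ℝ), IsProbabilityMeasure (P (g s '' D.carrier) δ) ∧
        F (s + h) δ * ((P (g s '' D.carrier) δ) (Conf s h δ)).toReal =
          ∫ γ in Conf s h δ, f γ.curve ∂(P (g s '' D.carrier) δ) :=
      hR D a b hab u U hU hDU hud huc hua hub g hg t₀ ht₀ hg0 hgL hgd hgD hreach f s hs h hh0 hsh
    have eV : ∀ᶠ δ in 𝓝[>] (0:ℝ), q s h δ ≤ L * h := HV s hs h ⟨hh0, hh1⟩ hsh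
    have eP : ∀ᶠ δ in 𝓝[>] (0:ℝ), |(A s h δ - F s δ * q s h δ) + h * Cv s δ| ≤ η / 3 * h :=
      HP s hs h ⟨hh0, hh2⟩ hsh
    have eC : ∀ᶠ δ in 𝓝[>] (0:ℝ), |h * Cv s δ - (J (s + h) δ - J s δ)| ≤ η / 3 * h :=
      HC s hs h ⟨hh0, hh3⟩ hsh
    filter_upwards [eR, eV, eP, eC] with δ hRδ hVδ hPδ hCδ
    obtain ⟨hprob, hid⟩ := hRδ
    -- measure theory at this mesh
    have hq1 : ((P (g s '' D.carrier) δ) (Conf s h δ)).toReal = 1 - q s h δ :=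
      toReal_eq_one_sub_toReal_compl _ _
    have hAF : ∫ γ in Conf s h δ, f γ.curve ∂(P (g s '' D.carrier) δ) = F s δ - A s h δ :=
      setIntegral_eq_integral_sub_compl f _ _
    have hΘ : |A s h δ - F s δ * q s h δ| ≤ 2 * B * q s h δ :=
      abs_setIntegral_sub_mul_le f _ _
    rw [hq1, hAF] at hid
    -- the abstract one-step estimate
    have hqL : q s h δ ≤ L' * h :=
      hVδ.trans (mul_le_mul_of_nonneg_right (le_max_left _ _) hh0.le)
    have hLh : L' * h ≤ 1 / 2 := by
      calc L' * h ≤ L' * (1 / (2 * L')) := by gcongr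
        _ = 1 / 2 := by field_simp
    have hsmall : 4 * B * L' ^ 2 * h ≤ η / 3 := by
      have h1 : 4 * B * L' ^ 2 * h ≤ (4 * B * L' ^ 2 + 1) * h := by nlinarith
      have h2 : (4 * B * L' ^ 2 + 1) * h ≤ η / 3 := by
        rwa [← le_div_iff₀' (by positivity)] 
      exact h1.trans h2
    have key := abs_step_le (B := B) (L := L') (η := η / 3) hB0 hh0.le ENNReal.toReal_nonneg hqL
      hLh hid hΘ hPδ hCδ hsmall
    calc |F (s + h) δ - F s δ - (J (s + h) δ - J s δ)| ≤ 3 * (η / 3) * h := key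
      _ = η * h := by ring
  -- Step 2: telescoping, and identification with the crux's conclusion
  have key := tendsto_of_uniform_steps hsteps ht
  have h0 : g 0 '' D.carrier = D.carrier := by
    have : g 0 = id := funext hg0
    rw [this, Set.image_id]
  have hF0 : ∀ δ', F 0 δ' = ∫ γ, f γ.curve ∂(P D.carrier δ') := by
    intro δ'
    show (fun Ω => ∫ γ, f γ.curve ∂(P Ω δ')) (g 0 '' D.carrier) =
      (fun Ω => ∫ γ, f γ.curve ∂(P Ω δ')) D.carrier
    rw [h0]
  have hJ0 : ∀ δ', J 0 δ' = 0 := fun δ' => intervalIntegral.integral_same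
  refine key.congr fun δ' => ?_
  rw [hF0 δ', hJ0 δ', sub_zero]

/-- By-name form: the four pieces imply the route decl `SAWQuadrupoleWard.BoundaryWard` itself
(definitional unfolding of the crux; this is the type the gate renders for `--glue-by`). [folklore] -/
theorem boundaryWard_of_subs'
    (hR : ∀ (D : Literature.Probability.RandomPlanarGeometry.DobrushinDomain) (a b : ℝ → Literature.Probability.LatticeModels.Site 2), Literature.Probability.RandomPlanarGeometry.SAW.IsEndpointApprox D a b → let P := fun (Ω : Set ℂ) (δ : ℝ) => Literature.Probability.RandomPlanarGeometry.SAW.law Ω δ (a δ) (b δ); ∀ (u : ℂ → ℂ) (U : Set ℂ), IsOpen U → closure D.carrier ⊆ U → DifferentiableOn ℂ u U → ContDiff ℝ 2 u → u (D.pt 0) = 0 → u (D.pt 1) = 0 → ∀ (g : ℝ → ℂ → ℂ) (hg : ∀ t, Continuous (g t)) (t₀ : ℝ), 0 < t₀ → (∀ z, g 0 z = z) → (∀ t, ∃ K, LipschitzWith K (g t)) → (∀ t ∈ Set.Icc (0 : ℝ) t₀, ∀ z ∈ closure D.carrier, HasDerivAt (fun r => g r z) (u (g t z)) t) → (∀ t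 ∈ Set.Icc (0 : ℝ) t₀, g t '' D.carrier ⊆ D.carrier) → (∀ t ∈ Set.Icc (0 : ℝ) t₀, ∀ᶠ δ in nhdsWithin 0 (Set.Ioi 0), (Literature.Probability.LatticeModels.discreteDomainGraph (g t '' D.carrier) δ).Reachable (a δ) (b δ)) → ∀ f : BoundedContinuousFunction (Literature.Probability.RandomPlanarGeometry.CurveClass ℂ) ℝ, ∀ s ∈ Set.Icc (0 : ℝ) t₀, ∀ h : ℝ, 0 < h → s + h ≤ t₀ → ∀ᶠ δ in nhdsWithin 0 (Set.Ioi 0), MeasureTheory.IsProbabilityMeasure (P (g s '' D.carrier) δ) ∧ (∫ γ, f γ.curve ∂(P (g (s + h) '' D.carrier) δ)) * ((P (g s '' D.carrier) δ) {γ | ∃ γ' : Literature.Probability.RandomPlanarGeometry.SAW.DomainSAW (g (s + h) '' D.carrier) δ (a δ) (b δ), γ'.walk.support = γ.walk.support}).toReal = ∫ γ in {γ | ∃ γ' : Literature.Probability.RandomPlanarGeometry.SAW.DomainSAW (g (s + h) '' D.carrier) δ (a δ) (b δ), γ'.walk.support = γ.walk.support}, f γ.curve ∂(P (g s '' D.carrier)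 δ))
    (hV : ∀ (D : Literature.Probability.RandomPlanarGeometry.DobrushinDomain) (a b : ℝ → Literature.Probability.LatticeModels.Site 2), Literature.Probability.RandomPlanarGeometry.SAW.IsEndpointApprox D a b → let P := fun (Ω : Set ℂ) (δ : ℝ) => Literature.Probability.RandomPlanarGeometry.SAW.law Ω δ (a δ) (b δ); ∀ (u : ℂ → ℂ) (U : Set ℂ), IsOpen U → closure D.carrier ⊆ U → DifferentiableOn ℂ u U → ContDiff ℝ 2 u → u (D.pt 0) = 0 → u (D.pt 1) = 0 → ∀ (g : ℝ → ℂ → ℂ) (hg : ∀ t, Continuous (g t)) (t₀ : ℝ), 0 < t₀ → (∀ z, g 0 z = z) → (∀ t, ∃ K, LipschitzWith K (g t)) → (∀ t ∈ Set.Icc (0 : ℝ) t₀, ∀ z ∈ closure D.carrier, HasDerivAt (fun r => g r z) (u (g t z)) t) → (∀ t ∈ Set.Icc (0 : ℝ) t₀, g t '' D.carrier ⊆ D.carrier) → (∀ t ∈ Set.Icc (0 : ℝ) t₀, ∀ᶠ δ in nhdsWithin 0 (Set.Ioi 0), (Literature.Probability.LatticeModels.discreteDomainGraph (g t '' D.carrier)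 δ).Reachable (a δ) (b δ)) → ∃ L : ℝ, ∃ h₀ : ℝ, 0 < h₀ ∧ ∀ s ∈ Set.Icc (0 : ℝ) t₀, ∀ h ∈ Set.Ioc (0 : ℝ) h₀, s + h ≤ t₀ → ∀ᶠ δ in nhdsWithin 0 (Set.Ioi 0), ((P (g s '' D.carrier) δ) {γ | ∃ γ' : Literature.Probability.RandomPlanarGeometry.SAW.DomainSAW (g (s + h) '' D.carrier) δ (a δ) (b δ), γ'.walk.support = γ.walk.support}ᶜ).toReal ≤ L * h)
    (hP : ∀ κ₁ κ₂ : ℝ → ℝ, (∀ (D : Literature.Probability.RandomPlanarGeometry.DobrushinDomain) (a b : ℝ → Literature.Probability.LatticeModels.Site 2), Literature.Probability.RandomPlanarGeometry.SAW.IsEndpointApprox D a b → let P := fun (Ω : Set ℂ) (δ : ℝ) => Literature.Probability.RandomPlanarGeometry.SAW.law Ω δ (a δ) (b δ); ∀ (v : ℂ → ℂ), ContDiff ℝ 2 v → tsupport v ⊆ D.carrier → ∀ (φ : ℝ → ℂ → ℂ) (hφ : ∀ t, Continuous (φ t)), (∀ z, φ 0 z = z) → (∀ t z, HasDerivAt (fun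 r => φ r z) (v (φ t z)) t) → ∀ f : BoundedContinuousFunction (Literature.Probability.RandomPlanarGeometry.CurveClass ℂ) ℝ, let strain : (ℂ → ℂ) → ℂ → ℂ := fun w z => fderiv ℝ w z 1 + Complex.I * fderiv ℝ w z Complex.I; let quad : ℝ → (ℂ → ℂ) → List (Literature.Probability.LatticeModels.Site 2) → ℝ := fun δ s xs => let l := xs.map (Literature.Probability.LatticeModels.meshPoint δ); κ₁ δ * (List.zipWith (fun p q : ℂ => (s ((p + q) / 2)).re * (((q - p).re) ^ 2 - ((q - p).im) ^ 2) / δ ^ 2) l l.tail).sum + κ₂ δ * (List.zipWith3 (fun p q r : ℂ => (s q).im * ((r - p).re * (r - p).im) / δ ^ 2) l l.tail l.tail.tail).sum; let fbar : Literature.Probability.RandomPlanarGeometry.CurveClass ℂ → ℝ := fun c => ∫ t in (0 : ℝ)..1, f (Literature.Probability.RandomPlanarGeometry.CurveClass.map ⟨φ t, hφ t⟩ c); Filter.Tendsto (fun δ : ℝ => (∫ γ, f (Literature.Probability.RandomPlanarGeometry.CurveClass.map ⟨φ 1, hφ 1⟩ γ.curve) ∂(P D.carrier δ)) - (∫ γ,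 f γ.curve ∂(P D.carrier δ)) - ((∫ γ, fbar γ.curve * quad δ (strain v) γ.walk.support ∂(P D.carrier δ)) - (∫ γ, fbar γ.curve ∂(P D.carrier δ)) * (∫ γ, quad δ (strain v) γ.walk.support ∂(P D.carrier δ)))) (nhdsWithin 0 (Set.Ioi 0)) (nhds 0)) → ∀ (D : Literature.Probability.RandomPlanarGeometry.DobrushinDomain) (a b : ℝ → Literature.Probability.LatticeModels.Site 2), Literature.Probability.RandomPlanarGeometry.SAW.IsEndpointApprox D a b → let P := fun (Ω : Set ℂ) (δ : ℝ) => Literature.Probability.RandomPlanarGeometry.SAW.law Ω δ (a δ) (b δ); ∀ (u : ℂ → ℂ) (U : Set ℂ), IsOpen U → closure D.carrier ⊆ U → DifferentiableOn ℂ u U → ContDiff ℝ 2 u → u (D.pt 0) = 0 → u (D.pt 1) = 0 → ∀ (g : ℝ → ℂ → ℂ) (hg : ∀ t, Continuous (g t)) (t₀ : ℝ), 0 < t₀ → (∀ z, g 0 z = z) → (∀ t, ∃ K, LipschitzWith K (g t)) → (∀ t ∈ Set.Icc (0 : ℝ) t₀, ∀ z ∈ closure D.carrier, HasDerivAt (fun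 r => g r z) (u (g t z)) t) → (∀ t ∈ Set.Icc (0 : ℝ) t₀, g t '' D.carrier ⊆ D.carrier) → (∀ t ∈ Set.Icc (0 : ℝ) t₀, ∀ᶠ δ in nhdsWithin 0 (Set.Ioi 0), (Literature.Probability.LatticeModels.discreteDomainGraph (g t '' D.carrier) δ).Reachable (a δ) (b δ)) → ∀ (K : Set ℂ), IsCompact K → K ⊆ g t₀ '' D.carrier → ∀ (χ : ℂ → ℝ), ContDiff ℝ 2 χ → (∀ᶠ z in nhdsSet K, χ z = 1) → tsupport χ ⊆ g t₀ '' D.carrier → ∀ f : BoundedContinuousFunction (Literature.Probability.RandomPlanarGeometry.CurveClass ℂ) ℝ, (∀ ψ : ℂ ≃ₜ ℂ, (∀ z ∈ K, ψ z = z) → ∀ c, f (Literature.Probability.RandomPlanarGeometry.CurveClass.map (ψ : C(ℂ, ℂ)) c) = f c) → ∀ η : ℝ, 0 < η → ∃ h₀ : ℝ, 0 < h₀ ∧ ∀ s ∈ Set.Icc (0 : ℝ) t₀, ∀ h ∈ Set.Ioc (0 : ℝ) h₀, s + h ≤ t₀ → let strain : (ℂ → ℂ) → ℂ → ℂ :=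 fun w z => fderiv ℝ w z 1 + Complex.I * fderiv ℝ w z Complex.I; let quad : ℝ → (ℂ → ℂ) → List (Literature.Probability.LatticeModels.Site 2) → ℝ := fun δ s xs => let l := xs.map (Literature.Probability.LatticeModels.meshPoint δ); κ₁ δ * (List.zipWith (fun p q : ℂ => (s ((p + q) / 2)).re * (((q - p).re) ^ 2 - ((q - p).im) ^ 2) / δ ^ 2) l l.tail).sum + κ₂ δ * (List.zipWith3 (fun p q r : ℂ => (s q).im * ((r - p).re * (r - p).im) / δ ^ 2) l l.tail l.tail.tail).sum; let v : ℂ → ℂ := fun z => (χ z : ℂ) * u z; ∀ᶠ δ in nhdsWithin 0 (Set.Ioi 0), |((∫ γ in {γ | ∃ γ' : Literature.Probability.RandomPlanarGeometry.SAW.DomainSAW (g (s + h) '' D.carrier) δ (a δ) (b δ), γ'.walk.support = γ.walk.support}ᶜ, f γ.curve ∂(P (g s '' D.carrier) δ)) - (∫ γ, f γ.curve ∂(P (g s '' D.carrier) δ)) * ((P (g s '' D.carrier) δ) {γ | ∃ γ' : Literature.Probability.RandomPlanarGeometry.SAW.DomainSAW (g (s + h) '' D.carrier) δ (a δ) (b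 δ), γ'.walk.support = γ.walk.support}ᶜ).toReal) + h * ((∫ γ, f γ.curve * quad δ (strain v) γ.walk.support ∂(P (g s '' D.carrier) δ)) - (∫ γ, f γ.curve ∂(P (g s '' D.carrier) δ)) * (∫ γ, quad δ (strain v) γ.walk.support ∂(P (g s '' D.carrier) δ)))| ≤ η * h)
    (hC : ∀ κ₁ κ₂ : ℝ → ℝ, (∀ (D : Literature.Probability.RandomPlanarGeometry.DobrushinDomain) (a b : ℝ → Literature.Probability.LatticeModels.Site 2), Literature.Probability.RandomPlanarGeometry.SAW.IsEndpointApprox D a b → let P := fun (Ω : Set ℂ) (δ : ℝ) => Literature.Probability.RandomPlanarGeometry.SAW.law Ω δ (a δ) (b δ); ∀ (v : ℂ → ℂ), ContDiff ℝ 2 v → tsupport v ⊆ D.carrier → ∀ (φ : ℝ → ℂ → ℂ) (hφ : ∀ t, Continuous (φ t)), (∀ z, φ 0 z = z) → (∀ t z, HasDerivAt (fun r => φ r z) (v (φ t z)) t) → ∀ f : BoundedContinuousFunction (Literature.Probability.RandomPlanarGeometry.CurveClass ℂ) ℝ, let strain : (ℂ → ℂ) → ℂ → ℂ := fun w z =>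 fderiv ℝ w z 1 + Complex.I * fderiv ℝ w z Complex.I; let quad : ℝ → (ℂ → ℂ) → List (Literature.Probability.LatticeModels.Site 2) → ℝ := fun δ s xs => let l := xs.map (Literature.Probability.LatticeModels.meshPoint δ); κ₁ δ * (List.zipWith (fun p q : ℂ => (s ((p + q) / 2)).re * (((q - p).re) ^ 2 - ((q - p).im) ^ 2) / δ ^ 2) l l.tail).sum + κ₂ δ * (List.zipWith3 (fun p q r : ℂ => (s q).im * ((r - p).re * (r - p).im) / δ ^ 2) l l.tail l.tail.tail).sum; let fbar : Literature.Probability.RandomPlanarGeometry.CurveClass ℂ → ℝ := fun c => ∫ t in (0 : ℝ)..1, f (Literature.Probability.RandomPlanarGeometry.CurveClass.map ⟨φ t, hφ t⟩ c); Filter.Tendsto (fun δ : ℝ => (∫ γ, f (Literature.Probability.RandomPlanarGeometry.CurveClass.map ⟨φ 1, hφ 1⟩ γ.curve) ∂(P D.carrier δ)) - (∫ γ, f γ.curve ∂(P D.carrier δ)) - ((∫ γ, fbar γ.curve * quad δ (strain v) γ.walk.support ∂(P D.carrier δ)) - (∫ γ, fbar γ.curve ∂(P D.carrier δ)) * (∫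 γ, quad δ (strain v) γ.walk.support ∂(P D.carrier δ)))) (nhdsWithin 0 (Set.Ioi 0)) (nhds 0)) → ∀ (D : Literature.Probability.RandomPlanarGeometry.DobrushinDomain) (a b : ℝ → Literature.Probability.LatticeModels.Site 2), Literature.Probability.RandomPlanarGeometry.SAW.IsEndpointApprox D a b → let P := fun (Ω : Set ℂ) (δ : ℝ) => Literature.Probability.RandomPlanarGeometry.SAW.law Ω δ (a δ) (b δ); ∀ (u : ℂ → ℂ) (U : Set ℂ), IsOpen U → closure D.carrier ⊆ U → DifferentiableOn ℂ u U → ContDiff ℝ 2 u → u (D.pt 0) = 0 → u (D.pt 1) = 0 → ∀ (g : ℝ → ℂ → ℂ) (hg : ∀ t, Continuous (g t)) (t₀ : ℝ), 0 < t₀ → (∀ z, g 0 z = z) → (∀ t, ∃ K, LipschitzWith K (g t)) → (∀ t ∈ Set.Icc (0 : ℝ) t₀, ∀ z ∈ closure D.carrier, HasDerivAt (fun r => g r z) (u (g t z)) t) → (∀ t ∈ Set.Icc (0 : ℝ) t₀, g t '' D.carrier ⊆ D.carrier) → (∀ t ∈ Set.Icc (0 : ℝ) t₀, ∀ᶠ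 δ in nhdsWithin 0 (Set.Ioi 0), (Literature.Probability.LatticeModels.discreteDomainGraph (g t '' D.carrier) δ).Reachable (a δ) (b δ)) → ∀ (K : Set ℂ), IsCompact K → K ⊆ g t₀ '' D.carrier → ∀ (χ : ℂ → ℝ), ContDiff ℝ 2 χ → (∀ᶠ z in nhdsSet K, χ z = 1) → tsupport χ ⊆ g t₀ '' D.carrier → ∀ f : BoundedContinuousFunction (Literature.Probability.RandomPlanarGeometry.CurveClass ℂ) ℝ, (∀ ψ : ℂ ≃ₜ ℂ, (∀ z ∈ K, ψ z = z) → ∀ c, f (Literature.Probability.RandomPlanarGeometry.CurveClass.map (ψ : C(ℂ, ℂ)) c) = f c) → ∀ η : ℝ, 0 < η → ∃ h₀ : ℝ, 0 < h₀ ∧ ∀ s ∈ Set.Icc (0 : ℝ) t₀, ∀ h ∈ Set.Ioc (0 : ℝ) h₀, s + h ≤ t₀ → let strain : (ℂ → ℂ) → ℂ → ℂ := fun w z => fderiv ℝ w z 1 + Complex.I * fderiv ℝ w z Complex.I; let quad : ℝ → (ℂ → ℂ) → List (Literature.Probability.LatticeModels.Site 2) → ℝ := fun δ s xs => let l := xs.map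 (Literature.Probability.LatticeModels.meshPoint δ); κ₁ δ * (List.zipWith (fun p q : ℂ => (s ((p + q) / 2)).re * (((q - p).re) ^ 2 - ((q - p).im) ^ 2) / δ ^ 2) l l.tail).sum + κ₂ δ * (List.zipWith3 (fun p q r : ℂ => (s q).im * ((r - p).re * (r - p).im) / δ ^ 2) l l.tail l.tail.tail).sum; let v : ℂ → ℂ := fun z => (χ z : ℂ) * u z; let C : ℝ → ℝ → ℝ := fun r δ => ((∫ γ, f γ.curve * quad δ (strain v) γ.walk.support ∂(P (g r '' D.carrier) δ)) - (∫ γ, f γ.curve ∂(P (g r '' D.carrier) δ)) * (∫ γ, quad δ (strain v) γ.walk.support ∂(P (g r '' D.carrier) δ))); ∀ᶠ δ in nhdsWithin 0 (Set.Ioi 0), |h * C s δ - ((∫ r in (0 : ℝ)..(s + h), C r δ) - (∫ r in (0 : ℝ)..s, C r δ))| ≤ η * h) :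
    Summit.CriticalPhenomena.SAWScalingLimit.Theses.SAWQuadrupoleWard.BoundaryWard :=
  boundaryWard_of_subs hR hV hP hC

end Summit.CriticalPhenomena.SAWScalingLimit.Theorems.SAWQuadrupoleWardBoundaryWardSplit
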